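import Summits.CriticalPhenomena.PercolationContinuityZ3.Theorems.PercNearOneGluingNoHeavyConstsSixPointTwoLost
import HarnessLib

/-!
# (6P) ⇒ W: the weighted five-point inequality is the doubled case of the six-point inequality

builds on p205010 (kernel theorem, internal audit signed; external expert review pending)

Lane `prim/consts`, seat prim-consts-1 gen 11, helper file for the crux `NoHeavyLowerTail`
(stmt-CriticalPhenomena-4575; `--supports`): theorems only, no definitions, no sorries, standard axioms.

W (the "weighted five-point family (2,1,1,1; θ = 2)" of the block method, memo FROM-prim-consts-1-g11-GLUED-BLOCK.md §4):
observer `o`, a point `b` of weight two and three points `d₀, d₁, d₂` of weight one, all pairs `≤ s`-unreliable; W says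
`μ(b lost, or at least two of d₀, d₁, d₂ lost) ≤ (3/2)·s`.  Association methods cannot prove W (its vdBHK relaxation is `13/8`, kit
j151433), every percolation instance computed obeys it (famscan: sup `3/2` over 216 471 climbed instances).  This file records the
elementary reduction used throughout the memo: **W is the instance `x = (b, b, d₀, d₁, d₂)` of the six-point inequality
`Consts.SixPointTwoLost`** (repetitions are allowed there), so (6P) ⇒ W (`Consts.real_weightedFive_le_of_sixPoint`).
-/

noncomputable section

namespace Summit.CriticalPhenomena.PercolationContinuityZ3.Theorems

open MeasureTheory Set Literature.Probability.LatticeModels Literature.Probability.Percolation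
open scoped Classical

namespace Consts

/-- **(6P) ⇒ W.**  Assuming `Consts.SixPointTwoLost`: for an observer `o`, a doubled point `b ≠ o` and three unit points `d i ≠ o`
with `μ(o ↮ b), μ(o ↮ d i), μ(b ↮ d i), μ(d i ↮ d j) ≤ s`, the event "`b` is cut from `o`, or at least two of the `d i` are" has
probability at most `(3/2)·s` — apply (6P) to the quintuple `(b, b, d₀, d₁, d₂)`. [cite: KozmaNitzan2024, Conj. 4 (p. 32)] -/
theorem real_weightedFive_le_of_sixPoint (h6 : SixPointTwoLost) (n : ℕ) (w : Sym2 (Fin n) → unitInterval) (o b : Fin n)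
    (d : Fin 3 → Fin n) (hb : b ≠ o) (hd : ∀ i, d i ≠ o) {s : ℝ} (hs : 0 ≤ s)
    (hob : (prodBernoulli w).real (openConn o b)ᶜ ≤ s) (hod : ∀ i, (prodBernoulli w).real (openConn o (d i))ᶜ ≤ s)
    (hbd : ∀ i, (prodBernoulli w).real (openConn b (d i))ᶜ ≤ s)
    (hdd : ∀ i j, (prodBernoulli w).real (openConn (d i) (d j))ᶜ ≤ s) :
    (prodBernoulli w).real {ω : BondConfig (Fin n) | ω ∉ openConn o b ∨
        2 ≤ (Finset.univ.filter fun i => ω ∉ openConn o (d i)).card} ≤ 3 / 2 * s := by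
  -- the quintuple `x = (b, b, d 0, d 1, d 2)`
  set x : Fin 5 → Fin n := ![b, b, d 0, d 1, d 2] with hx
  have hx0 : x 0 = b := rfl
  have hx1 : x 1 = b := rfl
  have hxd : ∀ i : Fin 3, x ⟨(i : ℕ) + 2, by omega⟩ = d i := by
    intro i
    fin_cases i <;> rfl
  have hself : ∀ y : Fin n, (prodBernoulli w).real (openConn y y)ᶜ = 0 := fun y => by
    have : (openConn y y : Set (BondConfig (Fin n)))ᶜ = ∅ := by
      rw [Set.compl_empty_iff]; exact Set.eq_univ_of_forall fun ω => SimpleGraph.Reachable.refl _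
    rw [this, measureReal_empty]
  have hsymm : ∀ y z : Fin n, (openConn y z : Set (BondConfig (Fin n))) = openConn z y := fun y z => by
    ext ω; exact ⟨fun hc => SimpleGraph.Reachable.symm hc, fun hc => SimpleGraph.Reachable.symm hc⟩
  -- every entry of `x` is `b` or some `d i`
  have hcases : ∀ k : Fin 5, x k = b ∨ ∃ i, x k = d i := by
    intro k
    fin_cases k
    · exact Or.inl rfl
    · exact Or.inl rfl
    · exact Or.inr ⟨0, rfl⟩
    · exact Or.inr ⟨1, rfl⟩
    · exact Or.inr ⟨2, rfl⟩
  have hxo : ∀ k, x k ≠ o := by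
    intro k
    rcases hcases k with h | ⟨i, h⟩
    · rw [h]; exact hb
    · rw [h]; exact hd i
  have hox : ∀ k, (prodBernoulli w).real (openConn o (x k))ᶜ ≤ s := by
    intro k
    rcases hcases k with h | ⟨i, h⟩
    · rw [h]; exact hob
    · rw [h]; exact hod i
  have hxx : ∀ k k', (prodBernoulli w).real (openConn (x k) (x k'))ᶜ ≤ s := by
    intro k k'
    rcases hcases k with h | ⟨i, h⟩ <;> rcases hcases k' with h' | ⟨i', h'⟩ <;> rw [h, h']
    · rw [hself]; exact hs
    · exact hbd i'
    · rw [hsymm]; exact hbd i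
    · exact hdd i i'
  refine le_trans (measureReal_mono ?_ (measure_ne_top _ _)) (h6 n w o x hxo s hox hxx)
  -- event inclusion
  intro ω hω
  simp only [mem_setOf_eq] at hω ⊢
  rcases hω with hωb | hωd
  · -- entries 0 and 1 (both `b`) are lost
    refine Finset.one_lt_card.2 ⟨0, ?_, 1, ?_, by decide⟩
    · exact Finset.mem_filter.2 ⟨Finset.mem_univ _, by rw [hx0]; exact hωb⟩
    · exact Finset.mem_filter.2 ⟨Finset.mem_univ _, by rw [hx1]; exact hωb⟩
  · -- two lost `d i` give two lost entries `i + 2`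
    have hinj : Function.Injective (fun i : Fin 3 => (⟨(i : ℕ) + 2, by omega⟩ : Fin 5)) := by
      intro i j hij
      have := congrArg Fin.val hij
      ext; simp at this; omega
    calc 2 ≤ (Finset.univ.filter fun i => ω ∉ openConn o (d i)).card := hωd
      _ = ((Finset.univ.filter fun i => ω ∉ openConn o (d i)).image
            fun i : Fin 3 => (⟨(i : ℕ) + 2, by omega⟩ : Fin 5)).card := (Finset.card_image_of_injective _ hinj).symm
      _ ≤ (Finset.univ.filter fun k => ω ∉ openConn o (x k)).card := by
        refine Finset.card_le_card fun k hk => ?_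
        obtain ⟨i, hi, rfl⟩ := Finset.mem_image.1 hk
        exact Finset.mem_filter.2 ⟨Finset.mem_univ _, by rw [hxd i]; exact (Finset.mem_filter.1 hi).2⟩

end Consts

end Summit.CriticalPhenomena.PercolationContinuityZ3.Theorems
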